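import Literature.MathematicalPhysics.QuantumFieldTheory.BalabanImbrieJaffe1984to88.BIJ88Eq5134PolymerGas
import Literature.Probability.LatticeModels.ClusterExpansion

/-!
# `BalabanImbrieJaffe1984to88.BIJ88TypedGasLogZ308` — T. Bałaban, J. Imbrie, A. Jaffe, *Effective action and cluster properties of the
abelian Higgs model*, Commun. Math. Phys. **114** (1988) 257–315 [BalabanImbrieJaffe1988], §5.14 p. 308 [PDF 52]: **`exp(log z)` and the
expansion of `log z` FOR THE HONEST TYPED GAS** — the step, verbatim *"We treat z_F(Λ₁₂^{(k)}) as follows: z_F(Λ₁₂^{(k)}) =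
(z_F(Λ₁₂^{(k)})/z(Λ₁₂^{(k)})) exp(log z(Λ₁₂^{(k)})), where z(Λ₁₂^{(k)}) = z_{F=1}(Λ₁₂^{(k)}), and we give expansions for z_F/z and log z. The
first expansion will give rise to F^{m̄}_{k+1,loc} plus remainders, the second to 𝒫_{k+1,loc} plus remainders"*, instantiated — under an
EXPLICIT Kotecký–Preiss hypothesis, nothing about its validity being asserted — for the polymer gas which the honest bookkeeping of (5.13.4)
produces (`BIJ88TwoSpeciesPolymerGas`, `BIJ88Eq5134PolymerGas`: typed polymers `tpolys J₀ W`, incompatibility `tinc adj`), by the tree's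
abstract cluster expansion `Literature.Probability.LatticeModels.ClusterExpansion` ([KoteckyPreiss1986]).

statement-level skeleton of published theorems with citation tags; proofs where landed; nothing here is a claim about the Yang–Mills mass gap

PDF held: `paper:balaban1988-cmp114-bij-abelian-higgs-effective-action` (journal page = PDF page + 256); p. 308 = PDF 52 (render
`renders/original-p052-x2.png` of the p25 seat; text `p0052.txt`).

WHAT IS REPRODUCED (unit `lit-balaban-p25`, generation 9 of the Phase-2 proof seat p25; SKELETON row `C2.Eq5.14.1-5.14.2`; HOME
`run/shared/lean/pub/lit-balaban/lit-balaban-p25/`), theorems and instance plumbing only: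
* §1 the typed incompatibility is reflexive and symmetric AS INSTANCES (`Std.Refl (tinc adj)`, `Std.Symm (tinc adj)` — the standing hypotheses
  of `ClusterExpansion`); a `Decidable (IsPolymerCluster inc C)` plumbing instance; the general corollary `polymerLogZ_eq_sum_clusters`: in a
  KP volume, `log Z = Σ_{C ⊆ Λ, C a cluster} Φ^T(C)` ([KP86] (2) with the truncated functional vanishing off clusters), and
  `polymerPartitionFunction_div_eq_exp_of_eqOn`: `Z(w')/Z(w) = exp(Σ_{C ∩ D ≠ ∅} (Φ^T_{w'} − Φ^T_w)(C))` for activities agreeing off `D`.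
* §2 the typed gas in a KP volume (`hKP : IsKPVolume (tinc adj) w a (tpolys J₀ W)`, a HYPOTHESIS): **`typedGas_eq_exp_logZ`** (*"exp(log z)"*:
  `Ξ = exp(log Ξ)`), **`typedGas_logZ_eq_sum_clusters`** (*"log z"* expanded: `log Ξ = Σ_{tinc-clusters C ⊆ tpolys} Φ^T(C)` — clusters are
  connected through overlaps AND through abutting species-B pairs), `typedGas_sdiff_div_eq_exp` / `typedGas_div_eq_exp_of_eqOn` (ratios of partition
  functions localize on the clusters meeting the removed / modified polymers, [KP86] (5) — the mechanism of the ratio *"z_F/z"*).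
* §3 assembled with the identities of `BIJ88Eq5134PolymerGas`: **`twoSpecies_eq_mul_exp_sum_clusters`** (abstract weights) and
  **`exchange5134_eq_mul_exp_sum_clusters`**: the Mayer-summed decoupling expansion (5.13.4) equals `Π_□ g₂(□) · exp(Σ_{tinc-clusters C}
  Φ^T_ŵ(C))`, `ŵ(X,τ) = g₂^τ(X)/Π_{□⊆X} g₂(□)`, whenever `g₂(□) ≠ 0` and `ŵ` satisfies the KP condition on `tpolys J₀ W`.

**Reading note (GAPS.md G-C2-p25-03, concluded for §5.14).** For the honest two-species gas the printed programme of p. 308 goes through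
word for word: `z = Π_□ g₂(□) · Ξ`, `Ξ = exp(log Ξ)`, `log Ξ = Σ_clusters Φ^T` with clusters taken for the incompatibility `tinc` (so two
multi-region polymers that abut belong to the same cluster), all under the usual KP smallness of the relative activities — which this file
takes as a hypothesis and does not prove (it is the content of the estimates (5.14.4) ff.). NOT summit progress; NOT continuum; NOT Clay.
Imports: `BIJ88Eq5134PolymerGas`, `Literature.Probability.LatticeModels.ClusterExpansion`; modifies nothing. Cell `lit-balaban` Phase 2, seat
p25 gen 9; row C2.Eq5.14.1-5.14.2 (owner r16, referee ref-5).
-/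

open Finset
open Literature.Probability.LatticeModels (IsSetPartition setPartitions IsCompatible polymerPartitionFunction IsKPVolume polymerLogZ
  truncatedWeight IsPolymerCluster polymerLogZ_eq_sum_truncatedWeight exp_polymerLogZ_of_kp truncatedWeight_eq_zero_of_kp
  polymerPartitionFunction_sdiff_div_eq_exp truncatedWeight_congr)
open Literature.MathematicalPhysics.QuantumFieldTheory.BalabanImbrieJaffe1984to88.BIJ88ElementaryRegions304 (IsClosed regions)
open Literature.MathematicalPhysics.QuantumFieldTheory.BalabanImbrieJaffe1984to88.BIJ88Resummation5141 (polysIn restrictTo g2)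
open Literature.MathematicalPhysics.QuantumFieldTheory.BalabanImbrieJaffe1984to88.BIJ88PolymerRep5134 (IsAdmissible)
open Literature.MathematicalPhysics.QuantumFieldTheory.BalabanImbrieJaffe1984to88.BIJ88MayerExchange5134 (radj HardCore gA gB)
open Literature.MathematicalPhysics.QuantumFieldTheory.BalabanImbrieJaffe1984to88.BIJ88TwoSpeciesPolymerGas (tinc tpolys twt tinc_refl tinc_symm)
open Literature.MathematicalPhysics.QuantumFieldTheory.BalabanImbrieJaffe1984to88.BIJ88Eq5134PolymerGas
  (twoSpecies_eq_polymerPartitionFunction exchange5134_polymerPartitionFunction)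

namespace Literature.MathematicalPhysics.QuantumFieldTheory.BalabanImbrieJaffe1984to88.BIJ88TypedGasLogZ308

/-! ## §1 Instances and the cluster form of `log Z` -/

section Instances

variable {ι : Type*} (adj : ι → ι → Prop)

/-- the typed incompatibility is reflexive, as an instance (standing hypothesis `[Std.Refl inc]` of the abstract cluster expansion).
[cite: BalabanImbrieJaffe1988, (5.13.4) p.306] -/
instance instReflTinc : Std.Refl (tinc adj) := ⟨tinc_refl⟩

/-- the typed incompatibility is symmetric, as an instance (standing hypothesis `[Std.Symm inc]` of the abstract cluster expansion).
[cite: BalabanImbrieJaffe1988, (5.13.4) p.306] -/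
instance instSymmTinc : Std.Symm (tinc adj) := ⟨fun _ _ h => tinc_symm h⟩

end Instances

section Clusters

variable {P : Type*} [DecidableEq P] (inc : P → P → Prop) [DecidableRel inc]

/-- decidability of "`C` is a cluster" (non-Prop plumbing: the defining quantifier ranges over the sub-families of `C`). [folklore] -/
instance instDecidableIsPolymerCluster (C : Finset P) : Decidable (IsPolymerCluster inc C) :=
  decidable_of_iff (∀ C₁ ∈ C.powerset, C₁.Nonempty → (C \ C₁).Nonempty → ∃ γ₁ ∈ C₁, ∃ γ₂ ∈ C \ C₁, inc γ₁ γ₂)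
    (by simp only [IsPolymerCluster, mem_powerset])

variable {inc}

/-- **in a Kotecký–Preiss volume `log Z` is the sum of the truncated functionals over the CLUSTERS** ([KP86] (2), the non-clusters
contributing zero) — the shape of the printed *"expansion for log z"* of p. 308. [cite: BalabanImbrieJaffe1988, p.308 (Sect. 5.14)] -/
theorem polymerLogZ_eq_sum_clusters [Std.Refl inc] [Std.Symm inc] {w : P → ℂ} {a : P → ℝ} {Λ : Finset P}
    (hKP : IsKPVolume inc w a Λ) :
    polymerLogZ inc w Λ = ∑ C ∈ Λ.powerset with IsPolymerCluster inc C, truncatedWeight inc w C := by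
  rw [polymerLogZ_eq_sum_truncatedWeight]
  refine (sum_filter_of_ne fun C hC hne => ?_).symm
  by_contra hCl
  exact hne (truncatedWeight_eq_zero_of_kp hKP (mem_powerset.1 hC) hCl)

/-- **ratios of partition functions with activities modified on a set `D` localize on the clusters meeting `D`**: if `w'` agrees with
`w` off `D` and both are KP activities on `Λ`, then `Z(Λ; w')/Z(Λ; w) = exp(Σ_{C ⊆ Λ, C ∩ D ≠ ∅} (Φ^T_{w'}(C) − Φ^T_w(C)))` ([KP86] (2)
twice; `Φ^T(C)` depends only on the activities on `C`) — the mechanism of the printed *"expansion for z_F/z"* (the observables `F` modify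
the activities of the polymers containing them). [cite: BalabanImbrieJaffe1988, p.308 (Sect. 5.14)] -/
theorem polymerPartitionFunction_div_eq_exp_of_eqOn [Std.Refl inc] [Std.Symm inc] {w w' : P → ℂ} {a a' : P → ℝ} {Λ D : Finset P}
    (hKP : IsKPVolume inc w a Λ) (hKP' : IsKPVolume inc w' a' Λ) (hD : ∀ γ ∈ Λ, γ ∉ D → w' γ = w γ) :
    polymerPartitionFunction inc w' Λ / polymerPartitionFunction inc w Λ =
      Complex.exp (∑ C ∈ Λ.powerset with (C ∩ D).Nonempty, (truncatedWeight inc w' C - truncatedWeight inc w C)) := by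
  rw [← exp_polymerLogZ_of_kp hKP' Subset.rfl, ← exp_polymerLogZ_of_kp hKP Subset.rfl, ← Complex.exp_sub,
    polymerLogZ_eq_sum_truncatedWeight, polymerLogZ_eq_sum_truncatedWeight, ← sum_sub_distrib]
  congr 1
  refine (sum_filter_of_ne fun C hC hne => ?_).symm
  by_contra hCD
  rw [not_nonempty_iff_eq_empty] at hCD
  have hγ : ∀ γ ∈ C, w' γ = w γ := fun γ hγ =>
    hD γ (mem_powerset.1 hC hγ) fun hγD => (notMem_empty γ) (hCD ▸ mem_inter.2 ⟨hγ, hγD⟩)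
  exact hne (by rw [truncatedWeight_congr hγ, sub_self])

end Clusters

/-! ## §2 The typed gas in a Kotecký–Preiss volume -/

section Typed

variable {ι : Type*} [DecidableEq ι] (adj : ι → ι → Prop) [DecidableRel adj] (J₀ Ys : Finset (Finset ι)) (W : Finset ι)

/-- **p. 308 *"exp(log z(Λ₁₂))"* for the honest typed gas**: if the activities satisfy the Kotecký–Preiss condition on the typed polymers
(HYPOTHESIS `hKP`), the typed partition function is the exponential of its KP logarithm. [cite: BalabanImbrieJaffe1988, p.308 (Sect. 5.14)] -/
theorem typedGas_eq_exp_logZ {w : Finset ι × Bool → ℂ} {a : Finset ι × Bool → ℝ} (hKP : IsKPVolume (tinc adj) w a (tpolys J₀ W)) :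
    polymerPartitionFunction (tinc adj) w (tpolys J₀ W) = Complex.exp (polymerLogZ (tinc adj) w (tpolys J₀ W)) :=
  (exp_polymerLogZ_of_kp hKP Subset.rfl).symm

/-- **p. 308 *"we give expansions for … log z"* for the honest typed gas**: in a KP volume, `log Ξ` is the sum over the `tinc`-CLUSTERS of
typed polymers (families connected through overlapping supports and through abutting species-B pairs) of the truncated functionals.
[cite: BalabanImbrieJaffe1988, p.308 (Sect. 5.14)] -/
theorem typedGas_logZ_eq_sum_clusters {w : Finset ι × Bool → ℂ} {a : Finset ι × Bool → ℝ}
    (hKP : IsKPVolume (tinc adj) w a (tpolys J₀ W)) :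
    polymerLogZ (tinc adj) w (tpolys J₀ W) =
      ∑ C ∈ (tpolys J₀ W).powerset with IsPolymerCluster (tinc adj) C, truncatedWeight (tinc adj) w C :=
  polymerLogZ_eq_sum_clusters hKP

/-- **ratios through clusters** ([KP86] (5)) for the honest typed gas: removing a set `D` of typed polymers from a KP volume divides the
partition function by `exp` of the sum of the truncated functionals of the clusters meeting `D` — the mechanism by which a ratio of partition
functions such as the printed *"z_F/z"* localizes on the clusters touching the modified polymers. [cite: BalabanImbrieJaffe1988, p.308 (Sect. 5.14)] -/
theorem typedGas_sdiff_div_eq_exp {w : Finset ι × Bool → ℂ} {a : Finset ι × Bool → ℝ}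
    (hKP : IsKPVolume (tinc adj) w a (tpolys J₀ W)) (D : Finset (Finset ι × Bool)) :
    polymerPartitionFunction (tinc adj) w (tpolys J₀ W \ D) / polymerPartitionFunction (tinc adj) w (tpolys J₀ W) =
      Complex.exp (-∑ C ∈ (tpolys J₀ W).powerset with (C ∩ D).Nonempty, truncatedWeight (tinc adj) w C) :=
  polymerPartitionFunction_sdiff_div_eq_exp hKP

/-- **the *"expansion for z_F/z"* mechanism for the honest typed gas**: two KP activity assignments on the typed polymers that agree off a
set `D` (the polymers carrying the observables) have partition functions whose ratio is `exp` of the sum, over the clusters MEETING `D`, of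
the differences of truncated functionals. [cite: BalabanImbrieJaffe1988, p.308 (Sect. 5.14)] -/
theorem typedGas_div_eq_exp_of_eqOn {w w' : Finset ι × Bool → ℂ} {a a' : Finset ι × Bool → ℝ}
    (hKP : IsKPVolume (tinc adj) w a (tpolys J₀ W)) (hKP' : IsKPVolume (tinc adj) w' a' (tpolys J₀ W)) (D : Finset (Finset ι × Bool))
    (hD : ∀ p ∈ tpolys J₀ W, p ∉ D → w' p = w p) :
    polymerPartitionFunction (tinc adj) w' (tpolys J₀ W) / polymerPartitionFunction (tinc adj) w (tpolys J₀ W) =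
      Complex.exp (∑ C ∈ (tpolys J₀ W).powerset with (C ∩ D).Nonempty,
        (truncatedWeight (tinc adj) w' C - truncatedWeight (tinc adj) w C)) :=
  polymerPartitionFunction_div_eq_exp_of_eqOn hKP hKP' hD

/-! ## §3 Assembled with (5.13.4) -/

/-- **the honest two-species sum = background · `exp(Σ_clusters Φ^T)`** (abstract weights `a b`, `a(□) u(□) = 1`, KP HYPOTHESIS on the
relative activities). [cite: BalabanImbrieJaffe1988, p.308 (Sect. 5.14)] -/
theorem twoSpecies_eq_mul_exp_sum_clusters (a b u : Finset ι → ℂ) (hu : ∀ E ∈ regions J₀ W, a E * u E = 1)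
    {asz : Finset ι × Bool → ℝ}
    (hKP : IsKPVolume (tinc adj) (fun p => twt a b p * ∏ E ∈ (regions J₀ W).filter (· ⊆ p.1), u E) asz (tpolys J₀ W)) :
    ∑ Q ∈ (setPartitions W).filter (fun Q => ∀ X ∈ Q, IsClosed J₀ W X),
        ∑ M ∈ Q.powerset.filter (HardCore adj), (∏ X ∈ M, b X) * ∏ X ∈ Q \ M, a X =
      (∏ E ∈ regions J₀ W, a E) *
        Complex.exp (∑ C ∈ (tpolys J₀ W).powerset with IsPolymerCluster (tinc adj) C,
          truncatedWeight (tinc adj) (fun p => twt a b p * ∏ E ∈ (regions J₀ W).filter (· ⊆ p.1), u E) C) := by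
  rw [twoSpecies_eq_polymerPartitionFunction adj J₀ W a b u hu, typedGas_eq_exp_logZ adj J₀ W hKP,
    typedGas_logZ_eq_sum_clusters adj J₀ W hKP]

/-- **(5.13.4) summed over the Mayer data `= Π_□ g₂(□) · exp(Σ_{tinc-clusters} Φ^T_ŵ)`**, `ŵ(X,τ) = g₂^τ(X) / Π_{□⊆X} g₂(□)` — the displays
of p. 308 (*"z_F = (z_F/z) exp(log z)"*, the expansion of `log z`) for the honest typed gas, under the HYPOTHESES `g₂(□) ≠ 0` and KP for `ŵ` on
the typed polymers (the smallness the estimates (5.14.4) ff. are to supply; not asserted here). [cite: BalabanImbrieJaffe1988, p.308 (Sect. 5.14)] -/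
theorem exchange5134_eq_mul_exp_sum_clusters (hJ₀ : ∀ Y ∈ J₀, Y ⊆ W) (hYs : ∀ Y ∈ Ys, Y.Nonempty)
    (g : Finset ι → Finset (Finset ι) → ℂ) (hg2 : ∀ E ∈ regions J₀ W, g2 Ys g E ≠ 0) {asz : Finset ι × Bool → ℝ}
    (hKP : IsKPVolume (tinc adj)
      (fun p => twt (gA J₀ Ys g) (gB J₀ Ys g) p * ∏ E ∈ (regions J₀ W).filter (· ⊆ p.1), (g2 Ys g E)⁻¹) asz (tpolys J₀ W)) :
    ∑ S ∈ (polysIn Ys W).powerset,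
        ∑ P ∈ (setPartitions (regions (J₀ ∪ S) W)).filter (IsAdmissible (radj adj)),
          ∏ K ∈ P, g (K.biUnion id) (restrictTo S (K.biUnion id)) =
      (∏ E ∈ regions J₀ W, g2 Ys g E) *
        Complex.exp (∑ C ∈ (tpolys J₀ W).powerset with IsPolymerCluster (tinc adj) C,
          truncatedWeight (tinc adj)
            (fun p => twt (gA J₀ Ys g) (gB J₀ Ys g) p * ∏ E ∈ (regions J₀ W).filter (· ⊆ p.1), (g2 Ys g E)⁻¹) C) := by
  rw [exchange5134_polymerPartitionFunction adj J₀ Ys W hJ₀ hYs g hg2, typedGas_eq_exp_logZ adj J₀ W hKP,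
    typedGas_logZ_eq_sum_clusters adj J₀ W hKP]

end Typed

end Literature.MathematicalPhysics.QuantumFieldTheory.BalabanImbrieJaffe1984to88.BIJ88TypedGasLogZ308
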